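import Summits.MatrixMultiplication.MatrixMultiplication.Theorems.CharacteristicContinuityResidualChain
import Literature.Computability.AlgebraicComplexity.RectangularExponentAlpha
import Literature.Computability.AlgebraicComplexity.RectangularExponentProofs
import HarnessLib

/-!
# CharacteristicContinuityTransferThreshold — the transfer residual K′ on the shape dial
(decomp-mm cell, lens 5 «finite/base range + asymptotic regime + bridge», generation 16)

Support file for `route-MatrixMultiplication-CharacteristicContinuity` (rev 4, tribunal PASSED,
`closes (hW : LargeCharacteristicFast) (hK' : EventualTransfer)`; residual `EventualTransfer` = K′,
stmt-30790).  Write `ω_p := ω(𝔽̄_p)`, `ω₀ := ω(ℂ)`, `f(a) := ω_ℂ(1, a, 1)` (convex, `f(0) = 2`,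
`f(1) = ω₀`, `f ≡ 2` exactly on `[0, α]`, `α = dualExponentAlpha ℂ`).

K′ says: every exponent bound `β` valid in all large characteristics (`β ∈ eventualBounds`) bounds `ω₀`.
This file spreads K′ over the shape axis `a ∈ [0, 1]` of the rectangular formats `⟨n, n^a, n⟩`.
All new declarations are SETS of reals and one real number (no proposition is defined here):

* `chordRungs : Set ℝ`, `a ∈ chordRungs` iff `f(a) ≤ 2(1 − a) + a·β` for every eventual bound `β` —
  the characteristic-zero rectangular exponent at shape `a` lies below the CHORD from `(0, 2)` to
  `(1, β)`.  `1 ∈ chordRungs ↔ K′` (`one_mem_chordRungs_iff`); `K′ → a ∈ chordRungs` for every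
  `a ∈ [0,1]` (convexity of `f`, Lotti–Romani); the rungs are DOWNWARD CLOSED in the shape
  (`chordRungs_anti`) and `[0,1] ∩ chordRungs` is the closed interval `[0, a⋆]`
  (`rungSet_eq_Icc`), `a⋆ := transferThreshold`.
* BASE RANGE (proved): `a ∈ chordRungs` for every `0 ≤ a ≤ α` (`mem_chordRungs_of_le_dualExponentAlpha`:
  where `f` sits at the information floor `2` nothing has to be transferred), in particular for
  `a ≤ 0.321334` under the named fact `vxxz2024_alpha_ge` (and for `a ≤ log 4/(5 log 5) > 0.1722`
  by `coppersmith1982_le_dualExponentAlpha` of `Literature/…/Coppersmith1982RapidRectangular`, in tree,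
  not imported here).  So `α ≤ a⋆ ≤ 1`.
* ASYMPTOTIC REGIME + BRIDGE (proved): a single rung gives the DEFECTIVE transfer
  `ω₀ ≤ β + (1 − a)(3 − β)` (`omega_le_of_mem_chordRungs`, zero padding `ω ≤ ω(1,a,1) + (1 − a)`),
  whose loss vanishes as `a → 1⁻`; hence the rungs along ANY germ `[a₀, 1)` already give K′
  (`eventualTransfer_of_chordRungs_germ`) and
  `K′ ↔ [0,1) ⊆ chordRungs ↔ a⋆ = 1` (`eventualTransfer_iff_transferThreshold_eq_one`).
* THE TWO THRESHOLDS: `S ↔ α = 1` (`dualExponentAlpha_eq_one_iff`, in tree) and `S ↔ W ∧ a⋆ = 1`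
  (`matrixMultiplication_iff_fast_and_transferThreshold_eq_one`) with `α ≤ a⋆`: the residual K′ is
  the summit's own dial statement `· = 1` for a threshold that dominates `α`.  Under `W` the chords
  pinch to the floor and the two thresholds COINCIDE (`transferThreshold_eq_dualExponentAlpha_of_fast`):
  the tautology `W → (K′ ↔ S)` of the exact cut, made quantitative.  Necessity: `S → a ∈ chordRungs`
  for all `a ∈ [0,1]` and `S → a⋆ = 1`.

Reading for the lens.  On the residual's shape dial the «finite range» `[0, α]` is a theorem (and
non-trivially so: `α > 0` is Coppersmith 1982), the «bridge» (padding) is a theorem, and the whole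
residual is the statement that the proved range reaches the germ at `a = 1`; a rung `a ∈ chordRungs`
with `α < a < 1` compares `f(a) > 2` with characteristic-`p` square bounds and is transfer-type
(same technique class as K′); rungs below the true `α` are characteristic-free.  Nothing here proves
K′ or `ω = 2`; no item changes; rung count of the route unchanged.

References: [cite: BurgisserClausenShokrollahi1997, Cor. (15.18), Thm. (15.51)];
[cite: LottiRomani1983, §2 (convexity of x ↦ ω(x,1,1))]; [cite: LeGall2012, §1 (α, padding (1))];
[cite: VassilevskaWilliamsXuXuZhou2024, §1 (α = 1 iff ω = 2)];
[cite: ChristandlLeGallLysikovZuiddam2025, Rem. 3.13].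
-/

set_option linter.dupNamespace false -- `MatrixMultiplication.MatrixMultiplication` (summit = problem, D-0017)

noncomputable section

open Literature.Computability.AlgebraicComplexity
open Summit.MatrixMultiplication.MatrixMultiplication.Theses.CharacteristicContinuity
open Summit.MatrixMultiplication.MatrixMultiplication.Theorems.CharacteristicContinuityEventualTransfer
open Summit.MatrixMultiplication.MatrixMultiplication.Theorems.CharacteristicContinuityResidualChain

namespace Summit.MatrixMultiplication.MatrixMultiplication.Theorems.CharacteristicContinuityTransferThreshold

/-! ## Eventual bounds along the primes -/

/-- `eventualBounds`: the set of exponent bounds `β` with `ω(𝔽̄_p) ≤ β` in all large characteristics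
`p` (the hypothesis of the route's residual `EventualTransfer`). [cite: BurgisserClausenShokrollahi1997, §15.3] -/
def eventualBounds : Set ℝ :=
  {β : ℝ | ∃ p₀ : ℕ, ∀ (p : ℕ) [Fact p.Prime], p₀ ≤ p → omega (AlgebraicClosure (ZMod p)) ≤ β}

/-- Membership in `eventualBounds`, unfolded (definitional). [folklore] -/
theorem mem_eventualBounds_iff {β : ℝ} :
    β ∈ eventualBounds ↔
      ∃ p₀ : ℕ, ∀ (p : ℕ) [Fact p.Prime], p₀ ≤ p → omega (AlgebraicClosure (ZMod p)) ≤ β :=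
  Iff.rfl

/-- K′ unfolded over `eventualBounds` (definitional). [folklore] -/
theorem eventualTransfer_iff_eventualBounds :
    EventualTransfer ↔ ∀ β : ℝ, β ∈ eventualBounds → omega ℂ ≤ β :=
  Iff.rfl

/-- An eventual bound is at least `2` (there are primes beyond `p₀`, and `2 ≤ ω` over every field).
[cite: BurgisserClausenShokrollahi1997, §15.3] -/
theorem two_le_of_mem_eventualBounds {β : ℝ} (h : β ∈ eventualBounds) : 2 ≤ β := by
  obtain ⟨p₀, hp₀⟩ := h
  obtain ⟨p, hp₀p, hp⟩ := Nat.exists_infinite_primes p₀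
  haveI : Fact p.Prime := ⟨hp⟩
  exact (omega_two_le (AlgebraicClosure (ZMod p))).trans (hp₀ p hp₀p)

/-- Eventual bounds are upward closed. [folklore] -/
theorem mem_eventualBounds_of_le {β β' : ℝ} (h : β ∈ eventualBounds) (hββ' : β ≤ β') :
    β' ∈ eventualBounds := by
  obtain ⟨p₀, hp₀⟩ := h
  exact ⟨p₀, fun p _ hp => (hp₀ p hp).trans hββ'⟩

/-- Under `W` every `2 + ε` is an eventual bound (definitional). [folklore] -/
theorem mem_eventualBounds_of_fast (hW : LargeCharacteristicFast) {ε : ℝ} (hε : 0 < ε) :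
    2 + ε ∈ eventualBounds :=
  hW ε hε

/-! ## The rungs: chord transfer at shape `a` -/

/-- `chordRungs`: the set of shapes `a` with `ω_ℂ(1, a, 1) ≤ 2(1 − a) + a·β` for every eventual bound
`β` — the characteristic-zero rectangular exponent at shape `a` lies below the chord from `(0, 2)` to
`(1, β)`. [cite: LottiRomani1983, §2] -/
def chordRungs : Set ℝ :=
  {a : ℝ | ∀ β : ℝ, β ∈ eventualBounds → omegaRect ℂ 1 a 1 ≤ 2 * (1 - a) + a * β}

/-- Membership in `chordRungs`, unfolded (definitional). [folklore] -/
theorem mem_chordRungs_iff {a : ℝ} :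
    a ∈ chordRungs ↔ ∀ β : ℝ, β ∈ eventualBounds → omegaRect ℂ 1 a 1 ≤ 2 * (1 - a) + a * β :=
  Iff.rfl

/-- The top rung is the residual: `1 ∈ chordRungs ↔ K′` (`ω(1,1,1) = ω`). [folklore] -/
theorem one_mem_chordRungs_iff : (1 : ℝ) ∈ chordRungs ↔ EventualTransfer := by
  rw [mem_chordRungs_iff, eventualTransfer_iff_eventualBounds]
  simp only [omegaRect_one_one_one, sub_self, mul_zero, one_mul, zero_add]

/-- Where `f(a) = ω_ℂ(1,a,1)` is at the floor `2`, the rung holds for free (`β ≥ 2`).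
[cite: LeGall2012, §1] -/
theorem mem_chordRungs_of_omegaRect_eq_two {a : ℝ} (ha : 0 ≤ a) (h : omegaRect ℂ 1 a 1 = 2) :
    a ∈ chordRungs := by
  rw [mem_chordRungs_iff]
  intro β hβ
  rw [h]
  nlinarith [mul_nonneg ha (sub_nonneg.2 (two_le_of_mem_eventualBounds hβ))]

/-- The bottom rung `a = 0` (`ω(1, 0, 1) = 2`). [folklore] -/
theorem zero_mem_chordRungs : (0 : ℝ) ∈ chordRungs :=
  mem_chordRungs_of_omegaRect_eq_two le_rfl (omegaRect_one_zero_one ℂ)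

/-- BASE RANGE: `a ∈ chordRungs` for every `0 ≤ a ≤ α = dualExponentAlpha ℂ`. [cite: LeGall2012, §1] -/
theorem mem_chordRungs_of_le_dualExponentAlpha {a : ℝ} (ha : 0 ≤ a) (h : a ≤ dualExponentAlpha ℂ) :
    a ∈ chordRungs :=
  mem_chordRungs_of_omegaRect_eq_two ha (omegaRect_eq_two_of_le_dualExponentAlpha ℂ h)

/-- The rung at `α` itself (`ω(1, α, 1) = 2`, the level set is closed). [cite: LeGall2012, §1] -/
theorem dualExponentAlpha_mem_chordRungs : dualExponentAlpha ℂ ∈ chordRungs :=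
  mem_chordRungs_of_le_dualExponentAlpha (dualExponentAlpha_nonneg ℂ) le_rfl

/-- BASE RANGE under the named fact `α ≥ 0.321334` (VXXZ 2024): `a ∈ chordRungs` for
`0 ≤ a ≤ 0.321334`. [cite: VassilevskaWilliamsXuXuZhou2024, §1.1] -/
theorem mem_chordRungs_of_vxxz2024 (hα : vxxz2024_alpha_ge) {a : ℝ} (ha : 0 ≤ a)
    (h : a ≤ 0.321334) : a ∈ chordRungs :=
  mem_chordRungs_of_omegaRect_eq_two ha (hα.omegaRect_eq_two h)

/-- The rungs are DOWNWARD CLOSED in the shape: `a ∈ chordRungs → a' ∈ chordRungs` for `0 ≤ a' ≤ a`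
(convexity of `k ↦ ω(1,k,1)` between `0` and `a`; the chords from `(0,2)` are linear).
[cite: LottiRomani1983, §2] -/
theorem chordRungs_anti {a a' : ℝ} (h : a ∈ chordRungs) (ha' : 0 ≤ a') (haa' : a' ≤ a) :
    a' ∈ chordRungs := by
  rw [mem_chordRungs_iff] at h ⊢
  intro β hβ
  rcases eq_or_lt_of_le ha' with hzero | ha'pos
  · rw [← hzero, omegaRect_one_zero_one]
    norm_num
  · have hapos : 0 < a := ha'pos.trans_le haa'
    have hane : a ≠ 0 := hapos.ne'
    have ht0 : 0 ≤ a' / a := div_nonneg ha' hapos.le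
    have ht1 : 0 ≤ 1 - a' / a := sub_nonneg.2 ((div_le_one hapos).2 haa')
    have hconv := (omegaRect_convexOn_one_mid_one ℂ).2 (Set.mem_Ici.2 (le_refl (0 : ℝ)))
      (Set.mem_Ici.2 hapos.le) ht1 ht0 (by ring)
    simp only [smul_eq_mul, mul_zero, zero_add] at hconv
    rw [div_mul_cancel₀ a' hane, omegaRect_one_zero_one] at hconv
    calc omegaRect ℂ 1 a' 1 ≤ (1 - a' / a) * 2 + a' / a * omegaRect ℂ 1 a 1 := hconv
      _ ≤ (1 - a' / a) * 2 + a' / a * (2 * (1 - a) + a * β) := by gcongr; exact h β hβ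
      _ = 2 * (1 - a') + a' * β := by field_simp; ring

/-- `K′ → a ∈ chordRungs` for every `a ∈ [0, 1]` (the top rung and downward closure).
[cite: LottiRomani1983, §2] -/
theorem mem_chordRungs_of_eventualTransfer (hK : EventualTransfer) {a : ℝ} (ha0 : 0 ≤ a)
    (ha1 : a ≤ 1) : a ∈ chordRungs :=
  chordRungs_anti (one_mem_chordRungs_iff.2 hK) ha0 ha1

/-- NECESSITY: `ω(ℂ) = 2 → a ∈ chordRungs` for every `a ∈ [0, 1]` (then `α = 1`).
[cite: VassilevskaWilliamsXuXuZhou2024, §1] -/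
theorem mem_chordRungs_of_matrixMultiplication (hS : _root_.MatrixMultiplication) {a : ℝ} (ha0 : 0 ≤ a)
    (ha1 : a ≤ 1) : a ∈ chordRungs :=
  mem_chordRungs_of_le_dualExponentAlpha ha0
    (ha1.trans_eq ((dualExponentAlpha_eq_one_iff ℂ).2 (_root_.MatrixMultiplication_iff.1 hS)).symm)

/-! ## The bridge: one rung gives a defective transfer, a germ of rungs gives K′ -/

/-- DEFECTIVE TRANSFER from a single rung: `a ∈ chordRungs` (`a ≤ 1`) and an eventual bound `β` give
`ω(ℂ) ≤ β + (1 − a)(3 − β)` (zero padding `ω ≤ ω(1,a,1) + (1 − a)`); the loss vanishes as `a → 1`.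
[cite: LeGall2012, §1 (1)] -/
theorem omega_le_of_mem_chordRungs {a : ℝ} (h : a ∈ chordRungs) (ha1 : a ≤ 1) {β : ℝ}
    (hβ : β ∈ eventualBounds) : omega ℂ ≤ β + (1 - a) * (3 - β) := by
  have hpad : omegaRect ℂ 1 1 1 ≤ omegaRect ℂ 1 a 1 + (1 - a) := omegaRect_one_mid_one_le_add ℂ ha1
  rw [omegaRect_one_one_one] at hpad
  have hc := (mem_chordRungs_iff.1 h) β hβ
  calc omega ℂ ≤ omegaRect ℂ 1 a 1 + (1 - a) := hpad
    _ ≤ 2 * (1 - a) + a * β + (1 - a) := by linarith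
    _ = β + (1 - a) * (3 - β) := by ring

/-- BRIDGE: the rungs along any germ `[a₀, 1)` (`a₀ < 1`) imply K′ (let `a → 1⁻` in the defective
transfer). [cite: LeGall2012, §1 (1)] -/
theorem eventualTransfer_of_chordRungs_germ {a₀ : ℝ} (ha₀ : a₀ < 1)
    (h : ∀ a : ℝ, a₀ ≤ a → a < 1 → a ∈ chordRungs) : EventualTransfer := by
  rw [eventualTransfer_iff_eventualBounds]
  intro β hβ
  refine le_of_forall_pos_le_add fun ε hε => ?_
  by_cases hβ3 : 3 ≤ β
  · have ha1 : max a₀ 0 < 1 := max_lt ha₀ one_pos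
    have hω := omega_le_of_mem_chordRungs (h (max a₀ 0) (le_max_left _ _) ha1) ha1.le hβ
    nlinarith [mul_nonneg (sub_nonneg.2 ha1.le) (sub_nonneg.2 hβ3)]
  · have h3β : 0 < 3 - β := by linarith
    set δ : ℝ := ε / (3 - β) with hδ
    have hδpos : 0 < δ := div_pos hε h3β
    have ha1 : max a₀ (1 - δ) < 1 := max_lt ha₀ (by linarith)
    have h1a : 1 - max a₀ (1 - δ) ≤ δ := by
      have := le_max_right a₀ (1 - δ)
      linarith
    have hω := omega_le_of_mem_chordRungs (h (max a₀ (1 - δ)) (le_max_left _ _) ha1) ha1.le hβ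
    have hprod : (1 - max a₀ (1 - δ)) * (3 - β) ≤ δ * (3 - β) :=
      mul_le_mul_of_nonneg_right h1a h3β.le
    have hδε : δ * (3 - β) = ε := by
      rw [hδ]
      exact div_mul_cancel₀ ε h3β.ne'
    linarith

/-- EXACTNESS ON THE DIAL: `K′ ↔ a ∈ chordRungs for every a ∈ [0, 1)`. [cite: LeGall2012, §1] -/
theorem eventualTransfer_iff_chordRungs :
    EventualTransfer ↔ ∀ a : ℝ, 0 ≤ a → a < 1 → a ∈ chordRungs :=
  ⟨fun hK _ ha0 ha1 => mem_chordRungs_of_eventualTransfer hK ha0 ha1.le,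
    fun h => eventualTransfer_of_chordRungs_germ zero_lt_one h⟩

/-- … and it suffices to have the rungs on a germ `[a₀, 1)`, `0 ≤ a₀ < 1`. [cite: LeGall2012, §1] -/
theorem eventualTransfer_iff_chordRungs_germ {a₀ : ℝ} (h0 : 0 ≤ a₀) (h1 : a₀ < 1) :
    EventualTransfer ↔ ∀ a : ℝ, a₀ ≤ a → a < 1 → a ∈ chordRungs :=
  ⟨fun hK _ ha0 ha1 => mem_chordRungs_of_eventualTransfer hK (h0.trans ha0) ha1.le,
    fun h => eventualTransfer_of_chordRungs_germ h1 h⟩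

/-! ## The transfer threshold `a⋆` -/

/-- The rung set on the unit interval, `[0,1] ∩ chordRungs`. [folklore] -/
def rungSet : Set ℝ :=
  Set.Icc (0 : ℝ) 1 ∩ chordRungs

/-- **The transfer threshold** `a⋆ := sup ([0,1] ∩ chordRungs)` — how far along the shape axis
characteristic-`p` exponent bounds are known to control characteristic zero. [folklore] -/
def transferThreshold : ℝ :=
  sSup rungSet

/-- Membership in the rung set (definitional). [folklore] -/
theorem mem_rungSet_iff {a : ℝ} : a ∈ rungSet ↔ a ∈ Set.Icc (0 : ℝ) 1 ∧ a ∈ chordRungs :=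
  Iff.rfl

/-- The rung set is nonempty (`a = 0`). [folklore] -/
theorem rungSet_nonempty : rungSet.Nonempty :=
  ⟨0, ⟨le_rfl, zero_le_one⟩, zero_mem_chordRungs⟩

/-- The rung set is bounded above by `1`. [folklore] -/
theorem rungSet_bddAbove : BddAbove rungSet :=
  ⟨1, fun _ ha => ha.1.2⟩

/-- A rung in `[0,1]` lies below the threshold. [folklore] -/
theorem le_transferThreshold {a : ℝ} (ha : a ∈ Set.Icc (0 : ℝ) 1) (h : a ∈ chordRungs) :
    a ≤ transferThreshold :=
  le_csSup rungSet_bddAbove ⟨ha, h⟩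

/-- `a⋆ ≤ 1`. [folklore] -/
theorem transferThreshold_le_one : transferThreshold ≤ 1 :=
  csSup_le rungSet_nonempty fun _ ha => ha.1.2

/-- `0 ≤ a⋆`. [folklore] -/
theorem transferThreshold_nonneg : 0 ≤ transferThreshold :=
  le_transferThreshold ⟨le_rfl, zero_le_one⟩ zero_mem_chordRungs

/-- **`α ≤ a⋆`**: the transfer threshold dominates the dual exponent. [cite: LeGall2012, §1] -/
theorem dualExponentAlpha_le_transferThreshold : dualExponentAlpha ℂ ≤ transferThreshold :=
  le_transferThreshold ⟨dualExponentAlpha_nonneg ℂ, dualExponentAlpha_le_one ℂ⟩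
    dualExponentAlpha_mem_chordRungs

/-- `0.321334 ≤ a⋆` under the named fact `α ≥ 0.321334`. [cite: VassilevskaWilliamsXuXuZhou2024, §1.1] -/
theorem transferThreshold_ge_of_vxxz2024 (hα : vxxz2024_alpha_ge) :
    (0.321334 : ℝ) ≤ transferThreshold :=
  le_transferThreshold ⟨by norm_num, by norm_num⟩ (mem_chordRungs_of_vxxz2024 hα (by norm_num) le_rfl)

/-- Every shape in `[0, a⋆)` is a rung. [folklore] -/
theorem mem_chordRungs_of_lt_transferThreshold {a : ℝ} (ha : 0 ≤ a) (h : a < transferThreshold) :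
    a ∈ chordRungs := by
  obtain ⟨a', ⟨_, hchord⟩, haa'⟩ := exists_lt_of_lt_csSup rungSet_nonempty h
  exact chordRungs_anti hchord ha haa'.le

/-- The rung set `chordRungs` is closed (continuity of `a ↦ ω(1,a,1)`, CLLZ Rem. 3.13, and of the
chords). [cite: ChristandlLeGallLysikovZuiddam2025, Rem. 3.13] -/
theorem isClosed_chordRungs : IsClosed chordRungs := by
  have hset : chordRungs =
      ⋂ β : ℝ, ⋂ (_ : β ∈ eventualBounds), {a : ℝ | omegaRect ℂ 1 a 1 ≤ 2 * (1 - a) + a * β} := by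
    ext a
    simp only [mem_chordRungs_iff, Set.mem_setOf_eq, Set.mem_iInter]
  rw [hset]
  exact isClosed_iInter fun β => isClosed_iInter fun _ =>
    isClosed_le (continuous_omegaRect_one_mid_one ℂ) (by fun_prop)

/-- The threshold is attained: `a⋆ ∈ chordRungs`. [folklore] -/
theorem transferThreshold_mem_chordRungs : transferThreshold ∈ chordRungs :=
  ((isClosed_Icc.inter isClosed_chordRungs).csSup_mem rungSet_nonempty rungSet_bddAbove).2

/-- The rung set is exactly the interval `[0, a⋆]`. [folklore] -/
theorem rungSet_eq_Icc : rungSet = Set.Icc 0 transferThreshold := by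
  ext a
  rw [mem_rungSet_iff]
  refine ⟨fun ha => ⟨ha.1.1, le_transferThreshold ha.1 ha.2⟩, fun ha => ?_⟩
  exact ⟨⟨ha.1, ha.2.trans transferThreshold_le_one⟩,
    chordRungs_anti transferThreshold_mem_chordRungs ha.1 ha.2⟩

/-- **K′ ↔ a⋆ = 1**: eventual transfer holds iff the transfer threshold reaches the square shape.
[cite: BurgisserClausenShokrollahi1997, Cor. (15.18)] -/
theorem eventualTransfer_iff_transferThreshold_eq_one : EventualTransfer ↔ transferThreshold = 1 := by
  constructor
  · intro hK
    exact le_antisymm transferThreshold_le_one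
      (le_transferThreshold ⟨zero_le_one, le_rfl⟩ (one_mem_chordRungs_iff.2 hK))
  · intro h
    exact eventualTransfer_iff_chordRungs.2 fun a ha0 ha1 =>
      mem_chordRungs_of_lt_transferThreshold ha0 (by rw [h]; exact ha1)

/-- NECESSITY on the dial: `ω(ℂ) = 2 → a⋆ = 1`. [cite: VassilevskaWilliamsXuXuZhou2024, §1] -/
theorem transferThreshold_eq_one_of_matrixMultiplication (hS : _root_.MatrixMultiplication) :
    transferThreshold = 1 :=
  eventualTransfer_iff_transferThreshold_eq_one.1
    ((matrixMultiplication_iff_fast_and_eventualTransfer'.1 hS).2)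

/-! ## The two thresholds: `S ↔ α = 1`, `S ↔ W ∧ a⋆ = 1`, and `a⋆ = α` under `W` -/

/-- The summit on its own dial: `ω(ℂ) = 2 ↔ α_ℂ = 1`. [cite: VassilevskaWilliamsXuXuZhou2024, §1] -/
theorem matrixMultiplication_iff_dualExponentAlpha_eq_one :
    _root_.MatrixMultiplication ↔ dualExponentAlpha ℂ = 1 := by
  rw [_root_.MatrixMultiplication_iff, dualExponentAlpha_eq_one_iff]

/-- **The route's exact cut on the dial**: `ω(ℂ) = 2 ↔ W ∧ a⋆ = 1` (with `α ≤ a⋆ ≤ 1`).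
[cite: BurgisserClausenShokrollahi1997, Cor. (15.18)] -/
theorem matrixMultiplication_iff_fast_and_transferThreshold_eq_one :
    _root_.MatrixMultiplication ↔ LargeCharacteristicFast ∧ transferThreshold = 1 := by
  rw [← eventualTransfer_iff_transferThreshold_eq_one]
  exact matrixMultiplication_iff_fast_and_eventualTransfer'

/-- Under `W` a rung is exactly a floor point of `f`: `a ∈ chordRungs ↔ ω_ℂ(1,a,1) = 2` (`0 ≤ a`;
the chords to `(1, 2 + ε)` pinch to the floor). [cite: LeGall2012, §1] -/
theorem mem_chordRungs_iff_of_fast (hW : LargeCharacteristicFast) {a : ℝ} (ha0 : 0 ≤ a) :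
    a ∈ chordRungs ↔ omegaRect ℂ 1 a 1 = 2 := by
  refine ⟨fun h => le_antisymm ?_ (two_le_omegaRect_one_mid_one ℂ a),
    mem_chordRungs_of_omegaRect_eq_two ha0⟩
  refine le_of_forall_pos_le_add fun ε hε => ?_
  rcases eq_or_lt_of_le ha0 with hzero | hapos
  · rw [← hzero, omegaRect_one_zero_one]
    exact le_add_of_nonneg_right hε.le
  · have hb := (mem_chordRungs_iff.1 h) (2 + ε / a) (mem_eventualBounds_of_fast hW (div_pos hε hapos))
    have e : 2 * (1 - a) + a * (2 + ε / a) = 2 + ε := by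
      field_simp
      ring
    linarith

/-- **Under `W` the two thresholds coincide: `a⋆ = α_ℂ`** — so, given `W`, the residual `a⋆ = 1` is
literally the summit's `α = 1`. [cite: VassilevskaWilliamsXuXuZhou2024, §1] -/
theorem transferThreshold_eq_dualExponentAlpha_of_fast (hW : LargeCharacteristicFast) :
    transferThreshold = dualExponentAlpha ℂ := by
  refine le_antisymm (csSup_le rungSet_nonempty fun a ha => ?_) dualExponentAlpha_le_transferThreshold
  exact le_dualExponentAlpha ℂ ha.1 ((mem_chordRungs_iff_of_fast hW ha.1.1).1 ha.2)

/-- Without `W`, the defective transfer from the rung at the dual exponent: every eventual bound `β`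
gives `ω(ℂ) ≤ β + (1 − α)(3 − β)` — the shape of what a rung at `a` buys: loss `(1 − a)(3 − β)`
(with `β = 2 + ε` under `W` this is the classical `ω ≤ 3 − α`). [cite: LeGall2012, §1 (1)] -/
theorem omega_le_of_mem_eventualBounds {β : ℝ} (hβ : β ∈ eventualBounds) :
    omega ℂ ≤ β + (1 - dualExponentAlpha ℂ) * (3 - β) :=
  omega_le_of_mem_chordRungs dualExponentAlpha_mem_chordRungs (dualExponentAlpha_le_one ℂ) hβ

end Summit.MatrixMultiplication.MatrixMultiplication.Theorems.CharacteristicContinuityTransferThreshold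

end
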